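import Summits.CriticalPhenomena.Ising3DConformalLimit.Theses.HyperoctahedralRP
import Summits.CriticalPhenomena.Ising3DConformalLimit.Theorems.InversionUpgradeNormalised.Negative.AutomaticOrders
import HarnessLib

/-!
# `InversionUpgradeNormalised` (stmt-CriticalPhenomena-1982) from a ONE-SIDED lattice ratio
# inequality — squeeze, reduction and composition of line `inversion-defect-involution`

Route `HyperoctahedralRP` (crux shared with PlanarCornerRotations / TauBallRounding / ModularBoosts),
sub-problem `Ising3DConformalLimit`; line `inversion-defect-involution` (registered skeleton
`Cruxes/InversionUpgradeNormalised/Lines/inversion-defect-involution.lean`).  The crux: every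
normalised, non-degenerate, Euclidean-invariant, scale-covariant (weight `Δ`) pointwise scaling
limit `S` of `criticalCorr 3` (`ρ > 0` on `(0,1]`) is `IsInversionCovariant Δ S`.

PROVED (sorry-free, no definitions): the SQUEEZE `isInversionCovariant_of_oneSided` (a one-sided
inequality `S_n(ιx) ≤ (∏‖xᵢ‖^{2Δ}) S_n(x)` on the punctured open unit ball is inversion covariance,
by dilation homogeneity and `ι`-oddness of the defect); the REDUCTION `oneSided_of_ratio` (the
limit-ratio inequality `R_S(x) ≤ R_S(ιx)`, `R_S = S_n S_2/S_{n+2}`, at even `n ≥ 2` gives the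
one-sided inequality at all orders); the COMPOSITION `InversionUpgradeNormalised_of_stubs`
(the crux from the four registered stubs stated as hypotheses VERBATIM — A = `stub_evenPos`,
LANDED p71996, B = `stub_ratioTransfer`, LANDED p71926, and the two open ones C = `stub_latticeFour`,
D = `stub_latticeHigher`: eventually as `δ → 0⁺`, `R^δ_n(x) ≤ R^δ_n(ιx) + ε` for the weight-free ratios
`R^δ_n = G_n G_2/G_{n+2}` of `criticalCorr 3` — the `a ↔ b` connection probability of a sourced
double random current, Aizenman–Duminil-Copin, Ann. Math. 194 (2021) §3.2 — at `4` resp. even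
`≥ 6` sources in the punctured open unit ball); the versions with A, B
discharged and the CROSS-ROUTE BRIDGE stmt-4840 (`CurrentConnectionInvariance.RatioInversionInvariance`)
⇒ stmt-1982 are in the companion `HyperoctahedralRPInversionUpgradeNormalisedConditional.lean`
(C, D are one-sided halves of 4840).  Nothing here closes the item (C, D are open).  Orders `0`,
`2`, odd and the coincident locus are automatic (`Negative/AutomaticOrders.lean`, reused).  OPEN: exactly C and D
(Möbius covariance of the Ising₃ limit at even orders `≥ 4`, in weight-free lattice form); all
model-blind surrogates are refuted (`ScaleCovarianceNotMoebius`, `Negative/ReflectionMonotone.lean`,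
`Negative/SixPointWitness.lean`).
-/

noncomputable section

open Filter Topology
open Literature.Probability.LatticeModels EuclideanGeometry
open Summit.CriticalPhenomena.Ising3DConformalLimit.InversionUpgradeNormalisedNegative

namespace Summit.CriticalPhenomena.Ising3DConformalLimit.Cruxes.InversionUpgradeNormalised.InversionDefectInvolution

/-- `ι x = ‖x‖⁻² • x` for the unit inversion at the origin. [folklore] -/
theorem inv_eq (x : EuclideanSpace ℝ (Fin 3)) :
    inversion (0 : EuclideanSpace ℝ (Fin 3)) 1 x = (1 / ‖x‖) ^ 2 • x := by
  rw [inversion, dist_eq_norm, vsub_eq_sub, sub_zero, vadd_eq_add, add_zero]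

/-- The unit inversion anti-commutes with dilations: `ι (c • x) = c⁻¹ • ι x` (`c > 0`). [folklore] -/
theorem inv_smul {c : ℝ} (hc : 0 < c) (x : EuclideanSpace ℝ (Fin 3)) :
    inversion (0 : EuclideanSpace ℝ (Fin 3)) 1 (c • x) =
      c⁻¹ • inversion (0 : EuclideanSpace ℝ (Fin 3)) 1 x := by
  rw [inv_eq, inv_eq, norm_smul, Real.norm_of_nonneg hc.le, smul_smul, smul_smul]
  by_cases hx : x = 0
  · simp [hx]
  · congr 1
    have hxn : ‖x‖ ≠ 0 := norm_ne_zero_iff.mpr hx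
    field_simp

/-- `‖ι x‖ = ‖x‖⁻¹`. [folklore] -/
theorem norm_inv (x : EuclideanSpace ℝ (Fin 3)) :
    ‖inversion (0 : EuclideanSpace ℝ (Fin 3)) 1 x‖ = ‖x‖⁻¹ := by
  have h := dist_inversion_center (0 : EuclideanSpace ℝ (Fin 3)) x (1 : ℝ)
  rwa [dist_eq_norm, dist_eq_norm, sub_zero, sub_zero, one_pow, one_div] at h

/-- `ι x ≠ 0` for `x ≠ 0`. [folklore] -/
theorem inv_ne_zero {x : EuclideanSpace ℝ (Fin 3)} (hx : x ≠ 0) :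
    inversion (0 : EuclideanSpace ℝ (Fin 3)) 1 x ≠ 0 := by
  rwa [Ne, inversion_eq_center one_ne_zero]

/-- Inverting an injective configuration gives an injective configuration. [folklore] -/
theorem injective_inv_comp {n : ℕ} {x : Fin n → EuclideanSpace ℝ (Fin 3)}
    (hx : Function.Injective x) :
    Function.Injective (fun i => inversion (0 : EuclideanSpace ℝ (Fin 3)) 1 (x i)) :=
  (inversion_injective (0 : EuclideanSpace ℝ (Fin 3)) one_ne_zero).comp hx

/-! ### The squeeze: a one-sided inequality on the punctured open ball IS inversion covariance -/

/-- Step 1 (dilation homogeneity of the inversion defect): scale covariance spreads the one-sided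
inequality `S_n(ιx) ≤ (∏‖xᵢ‖^{2Δ}) S_n(x)` from the punctured OPEN unit ball to every configuration
avoiding `0`. [folklore] -/
theorem oneSided_everywhere {Δ : ℝ} {S : CorrFamily 3} (hsc : IsScaleCovariant Δ S)
    (h : ∀ n (x : Fin n → EuclideanSpace ℝ (Fin 3)), (∀ i, x i ≠ 0) → (∀ i, ‖x i‖ < 1) →
      S n (fun i => inversion 0 1 (x i)) ≤ (∏ i, ‖x i‖ ^ (2 * Δ)) * S n x) :
    ∀ n (y : Fin n → EuclideanSpace ℝ (Fin 3)), (∀ i, y i ≠ 0) →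
      S n (fun i => inversion 0 1 (y i)) ≤ (∏ i, ‖y i‖ ^ (2 * Δ)) * S n y := by
  intro n y hy0
  set L : ℝ := 1 + ∑ i, ‖y i‖ with hL
  have hsum : 0 ≤ ∑ i, ‖y i‖ := Finset.sum_nonneg fun i _ => norm_nonneg _
  have hLpos : 0 < L := by linarith
  set l : ℝ := L⁻¹ with hl
  have hlpos : 0 < l := inv_pos.mpr hLpos
  have hly : ∀ i, ‖l • y i‖ < 1 := by
    intro i
    rw [norm_smul, Real.norm_of_nonneg hlpos.le, hl]
    have hi : ‖y i‖ ≤ ∑ j, ‖y j‖ :=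
      Finset.single_le_sum (f := fun j => ‖y j‖) (fun _ _ => norm_nonneg _) (Finset.mem_univ i)
    rw [inv_mul_lt_iff₀ hLpos]
    linarith
  have hly0 : ∀ i, l • y i ≠ 0 := fun i => smul_ne_zero hlpos.ne' (hy0 i)
  have key := h n (fun i => l • y i) hly0 hly
  have lhs : S n (fun i => inversion 0 1 (l • y i)) =
      l ^ ((n : ℝ) * Δ) * S n (fun i => inversion 0 1 (y i)) := by
    have h1 : (fun i => inversion (0 : EuclideanSpace ℝ (Fin 3)) 1 (l • y i)) =
        fun i => l⁻¹ • inversion (0 : EuclideanSpace ℝ (Fin 3)) 1 (y i) := by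
      funext i; exact inv_smul hlpos (y i)
    rw [h1, hsc n l⁻¹ (inv_pos.mpr hlpos)]
    congr 1
    rw [Real.inv_rpow hlpos.le, neg_mul, Real.rpow_neg hlpos.le, inv_inv]
  have rhs : (∏ i, ‖l • y i‖ ^ (2 * Δ)) * S n (fun i => l • y i)
      = l ^ ((n : ℝ) * Δ) * ((∏ i, ‖y i‖ ^ (2 * Δ)) * S n y) := by
    have h2 : (∏ i, ‖l • y i‖ ^ (2 * Δ)) = l ^ ((2 * Δ) * (n : ℕ)) * ∏ i, ‖y i‖ ^ (2 * Δ) := by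
      have : ∀ i, ‖l • y i‖ ^ (2 * Δ) = l ^ (2 * Δ) * ‖y i‖ ^ (2 * Δ) := by
        intro i
        rw [norm_smul, Real.norm_of_nonneg hlpos.le, Real.mul_rpow hlpos.le (norm_nonneg _)]
      rw [Finset.prod_congr rfl fun i _ => this i, Finset.prod_mul_distrib, Finset.prod_const,
        Finset.card_univ, Fintype.card_fin, Real.rpow_mul_natCast hlpos.le]
    rw [h2, hsc n l hlpos]
    have h3 : l ^ ((2 * Δ) * (n : ℕ)) * l ^ (-(n : ℝ) * Δ) = l ^ ((n : ℝ) * Δ) := by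
      rw [← Real.rpow_add hlpos]; congr 1; ring
    calc l ^ ((2 * Δ) * (n : ℕ)) * (∏ i, ‖y i‖ ^ (2 * Δ)) * (l ^ (-(n : ℝ) * Δ) * S n y)
        = (l ^ ((2 * Δ) * (n : ℕ)) * l ^ (-(n : ℝ) * Δ)) * ((∏ i, ‖y i‖ ^ (2 * Δ)) * S n y) := by
          ring
      _ = l ^ ((n : ℝ) * Δ) * ((∏ i, ‖y i‖ ^ (2 * Δ)) * S n y) := by rw [h3]
  rw [lhs, rhs] at key
  exact le_of_mul_le_mul_left key (Real.rpow_pos_of_pos hlpos _)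

/-- Step 2 (`ι`-oddness of the defect) — **THE SQUEEZE**: for a scale-covariant family the
one-sided inequality `S_n(ιx) ≤ (∏‖xᵢ‖^{2Δ}) S_n(x)` on the punctured open unit ball implies full
inversion covariance (apply the spread inequality to `ι x` and use `ι ∘ ι = id`, `‖ι x‖ = ‖x‖⁻¹`).
No positivity of `S`, no rotations. [folklore] -/
theorem isInversionCovariant_of_oneSided {Δ : ℝ} {S : CorrFamily 3}
    (hsc : IsScaleCovariant Δ S)
    (h : ∀ n (x : Fin n → EuclideanSpace ℝ (Fin 3)), (∀ i, x i ≠ 0) → (∀ i, ‖x i‖ < 1) →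
      S n (fun i => inversion 0 1 (x i)) ≤ (∏ i, ‖x i‖ ^ (2 * Δ)) * S n x) :
    IsInversionCovariant Δ S := by
  intro n x hx0
  have h1 := oneSided_everywhere hsc h n x hx0
  have h2 := oneSided_everywhere hsc h n (fun i => inversion 0 1 (x i)) (fun i => inv_ne_zero (hx0 i))
  have hιι : (fun i => inversion (0 : EuclideanSpace ℝ (Fin 3)) 1
      (inversion (0 : EuclideanSpace ℝ (Fin 3)) 1 (x i))) = x := by
    funext i; exact inversion_inversion (0 : EuclideanSpace ℝ (Fin 3)) one_ne_zero (x i)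
  have hP : (∏ i, ‖inversion (0 : EuclideanSpace ℝ (Fin 3)) 1 (x i)‖ ^ (2 * Δ)) =
      (∏ i, ‖x i‖ ^ (2 * Δ))⁻¹ := by
    rw [← Finset.prod_inv_distrib]
    refine Finset.prod_congr rfl fun i _ => ?_
    rw [norm_inv (x i), Real.inv_rpow (norm_nonneg _)]
  rw [hιι, hP] at h2
  have hPpos : 0 < ∏ i, ‖x i‖ ^ (2 * Δ) :=
    Finset.prod_pos fun i _ => Real.rpow_pos_of_pos (norm_pos_iff.mpr (hx0 i)) _
  have h3 : (∏ i, ‖x i‖ ^ (2 * Δ)) * S n x ≤ S n (fun i => inversion 0 1 (x i)) := by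
    have := mul_le_mul_of_nonneg_left h2 hPpos.le
    rwa [← mul_assoc, mul_inv_cancel₀ hPpos.ne', one_mul] at this
  exact le_antisymm h1 h3

/-- The two-point inversion law on a configuration `x : Fin 2 → ℝ³` (injective, avoiding `0`):
`S 2 (ι ∘ x) = (∏ ‖x i‖^(2Δ)) S 2 x` (Euclid + scale; `two_point_inversion` of
`Negative/AutomaticOrders.lean`). [folklore] -/
theorem two_point_config {Δ : ℝ} {S : CorrFamily 3} (heuc : IsEuclideanInvariant S)
    (hsc : IsScaleCovariant Δ S) {x : Fin 2 → EuclideanSpace ℝ (Fin 3)}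
    (hinj : Function.Injective x) (hx0 : ∀ i, x i ≠ 0) :
    S 2 (fun i => inversion 0 1 (x i)) = (∏ i, ‖x i‖ ^ (2 * Δ)) * S 2 x := by
  have h01 : x 0 ≠ x 1 := fun h => by simpa using hinj h
  have hx : x = ![x 0, x 1] := by funext i; fin_cases i <;> rfl
  have hιx : (fun i => inversion (0 : EuclideanSpace ℝ (Fin 3)) 1 (x i)) =
      ![inversion 0 1 (x 0), inversion 0 1 (x 1)] := by funext i; fin_cases i <;> rfl
  rw [hιx, Fin.prod_univ_two]
  conv_rhs => rw [hx]
  exact two_point_inversion heuc hsc h01 (hx0 0) (hx0 1)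

/-! ### Ratio inequality ⇒ weighted one-sided inequality (induction over even orders) -/

/-- **Reduction.** For a family normalised off `NonCoincident`, with vanishing odd orders, positive
even orders, the exact two-point inversion law, and the LIMIT-ratio inequality
`S_m(x')S_2(x'')/S_{m+2}(x) ≤ S_m(ιx')S_2(ιx'')/S_{m+2}(ιx)` at every even `m ≥ 2` for `x` in the
punctured open unit ball (`x'` = first `m` points, `x''` = last two), the one-sided inequality
`S_n(ιx) ≤ (∏‖xᵢ‖^{2Δ}) S_n(x)` holds at every order on the punctured open ball (strong induction on
even orders: `S_{m+2}(ιx) = S_m(ιx')S_2(ιx'')/R_S(ιx) ≤ w'S_m(x')·w''S_2(x'')/R_S(x) = w S_{m+2}(x)`,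
the weights multiplying up by `Fin.prod_univ_add`). [folklore] -/
theorem oneSided_of_ratio {Δ : ℝ} {S : CorrFamily 3}
    (hnorm : ∀ n z, z ∉ NonCoincident 3 n → S n z = 0)
    (hodd : ∀ n : ℕ, Odd n → ∀ x ∈ NonCoincident 3 n, S n x = 0)
    (hpos : ∀ n : ℕ, Even n → ∀ x ∈ NonCoincident 3 n, 0 < S n x)
    (h2 : ∀ x : Fin 2 → EuclideanSpace ℝ (Fin 3), Function.Injective x → (∀ i, x i ≠ 0) →
      S 2 (fun i => inversion 0 1 (x i)) = (∏ i, ‖x i‖ ^ (2 * Δ)) * S 2 x)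
    (hratio : ∀ n : ℕ, Even n → 2 ≤ n → ∀ x : Fin (n + 2) → EuclideanSpace ℝ (Fin 3),
      x ∈ NonCoincident 3 (n + 2) → (∀ i, x i ≠ 0) → (∀ i, ‖x i‖ < 1) →
      S n (fun i => x (Fin.castAdd 2 i)) * S 2 (fun i => x (Fin.natAdd n i)) /
            S (n + 2) x ≤
        S n (fun i => inversion 0 1 (x (Fin.castAdd 2 i))) * S 2 (fun i => inversion 0 1 (x (Fin.natAdd n i))) /
            S (n + 2) (fun i => inversion 0 1 (x i))) :
    ∀ n (x : Fin n → EuclideanSpace ℝ (Fin 3)), (∀ i, x i ≠ 0) → (∀ i, ‖x i‖ < 1) →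
      S n (fun i => inversion 0 1 (x i)) ≤ (∏ i, ‖x i‖ ^ (2 * Δ)) * S n x := by
  have heven : ∀ n : ℕ, Even n → ∀ x : Fin n → EuclideanSpace ℝ (Fin 3), Function.Injective x →
      (∀ i, x i ≠ 0) → (∀ i, ‖x i‖ < 1) →
      S n (fun i => inversion 0 1 (x i)) ≤ (∏ i, ‖x i‖ ^ (2 * Δ)) * S n x := by
    intro n
    induction n using Nat.strong_induction_on with
    | _ n ih =>
      intro hn x hinj hx0 hx1
      rcases Nat.lt_or_ge n 2 with hlt | hge
      · -- n = 0 (n = 1 is not even)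
        interval_cases n
        · have hx : (fun i => inversion (0 : EuclideanSpace ℝ (Fin 3)) 1 (x i)) = x :=
            funext fun i => Fin.elim0 i
          simp [hx]
        · exact absurd hn (by decide)
      rcases eq_or_lt_of_le hge with rfl | hgt
      · -- n = 2: the two-point law (equality)
        exact (h2 x hinj hx0).le
      · -- n = m + 2 with m ≥ 2 even
        obtain ⟨m, rfl⟩ := Nat.exists_eq_add_of_le' hge
        have hm2 : 2 ≤ m := by
          obtain ⟨k, rfl⟩ := (Nat.even_add.mp hn).mpr even_two
          omega
        have hm : Even m := (Nat.even_add.mp hn).mpr even_two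
        set x' : Fin m → EuclideanSpace ℝ (Fin 3) := fun i => x (Fin.castAdd 2 i) with hx'
        set x'' : Fin 2 → EuclideanSpace ℝ (Fin 3) := fun i => x (Fin.natAdd m i) with hx''
        have hinj' : Function.Injective x' := hinj.comp (Fin.castAdd_injective m 2)
        have hinj'' : Function.Injective x'' := hinj.comp (Fin.natAdd_injective 2 m)
        have hιinj : Function.Injective (fun i => inversion (0 : EuclideanSpace ℝ (Fin 3)) 1 (x i)) :=
          injective_inv_comp hinj
        have hιinj' : Function.Injective
            (fun i => inversion (0 : EuclideanSpace ℝ (Fin 3)) 1 (x' i)) := injective_inv_comp hinj'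
        have hιinj'' : Function.Injective
            (fun i => inversion (0 : EuclideanSpace ℝ (Fin 3)) 1 (x'' i)) := injective_inv_comp hinj''
        have hA : 0 < S (m + 2) x := hpos (m + 2) hn x hinj
        have hA' : 0 < S (m + 2) (fun i => inversion 0 1 (x i)) := hpos (m + 2) hn _ hιinj
        have hB : 0 < S m x' := hpos m hm x' hinj'
        have hB' : 0 < S m (fun i => inversion 0 1 (x' i)) := hpos m hm _ hιinj'
        have hC : 0 < S 2 x'' := hpos 2 even_two x'' hinj''
        have hC' : 0 < S 2 (fun i => inversion 0 1 (x'' i)) := hpos 2 even_two _ hιinj''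
        have hIH : S m (fun i => inversion 0 1 (x' i)) ≤ (∏ i, ‖x' i‖ ^ (2 * Δ)) * S m x' :=
          ih m (by omega) hm x' hinj' (fun i => hx0 _) (fun i => hx1 _)
        have hTwo : S 2 (fun i => inversion 0 1 (x'' i)) = (∏ i, ‖x'' i‖ ^ (2 * Δ)) * S 2 x'' :=
          h2 x'' hinj'' (fun i => hx0 _)
        have hR := hratio m hm hm2 x hinj hx0 hx1
        have hR' : S m x' * S 2 x'' * S (m + 2) (fun i => inversion 0 1 (x i)) ≤
            S m (fun i => inversion 0 1 (x' i)) * S 2 (fun i => inversion 0 1 (x'' i)) *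
              S (m + 2) x := by
          have := (div_le_div_iff₀ hA hA').1 hR
          simpa [hx', hx''] using this
        set w' : ℝ := ∏ i, ‖x' i‖ ^ (2 * Δ) with hw'
        set w'' : ℝ := ∏ i, ‖x'' i‖ ^ (2 * Δ) with hw''
        have hw : (∏ i, ‖x i‖ ^ (2 * Δ)) = w' * w'' := by
          rw [Fin.prod_univ_add]
        have hw'0 : 0 ≤ w' := Finset.prod_nonneg fun i _ => Real.rpow_nonneg (norm_nonneg _) _
        have hw''0 : 0 ≤ w'' := Finset.prod_nonneg fun i _ => Real.rpow_nonneg (norm_nonneg _) _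
        have hchain : S m x' * S 2 x'' * S (m + 2) (fun i => inversion 0 1 (x i)) ≤
            S m x' * S 2 x'' * ((w' * w'') * S (m + 2) x) := by
          calc S m x' * S 2 x'' * S (m + 2) (fun i => inversion 0 1 (x i))
              ≤ S m (fun i => inversion 0 1 (x' i)) * S 2 (fun i => inversion 0 1 (x'' i)) *
                  S (m + 2) x := hR'
            _ ≤ (w' * S m x') * (w'' * S 2 x'') * S (m + 2) x := by
                rw [hTwo]
                have h1 : S m (fun i => inversion 0 1 (x' i)) * (w'' * S 2 x'') ≤
                    (w' * S m x') * (w'' * S 2 x'') :=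
                  mul_le_mul_of_nonneg_right hIH (mul_nonneg hw''0 hC.le)
                exact mul_le_mul_of_nonneg_right h1 hA.le
            _ = S m x' * S 2 x'' * ((w' * w'') * S (m + 2) x) := by ring
        have hBC : 0 < S m x' * S 2 x'' := mul_pos hB hC
        rw [hw]
        exact le_of_mul_le_mul_left hchain hBC
  intro n x hx0 hx1
  by_cases hinj : Function.Injective x
  · rcases Nat.even_or_odd n with hn | hn
    · exact heven n hn x hinj hx0 hx1
    · rw [hodd n hn _ (injective_inv_comp hinj), hodd n hn x hinj, mul_zero]
  · have hιinj : ¬ Function.Injective (fun i => inversion (0 : EuclideanSpace ℝ (Fin 3)) 1 (x i)) :=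
      fun h => hinj fun i j hij => h (by simp only [hij])
    rw [hnorm n _ hιinj, hnorm n x hinj, mul_zero]

/-! ### The composition: the two remaining registered stubs (C, D) imply the crux, by name -/

/-- **`InversionUpgradeNormalised` from the four registered stubs of line
`inversion-defect-involution`, stated VERBATIM as hypotheses** (farm-independent form; the versions
with the LANDED stubs A = `stub_evenPos` (p71996) and B = `stub_ratioTransfer` (p71926) discharged
live in the companion file `HyperoctahedralRPInversionUpgradeNormalisedConditional.lean`).  A: even
orders of the limit are positive on `NonCoincident`; B: eventual lattice ratio inequalities pass to
the limit ratios; C (`stub_latticeFour`) / D (`stub_latticeHigher`): for the crux's data and `x`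
non-coincident in the punctured open unit ball, eventually as `δ → 0⁺`, `R^δ_n(x) ≤ R^δ_n(ιx) + ε`
for the weight-free ratios `R^δ_n = G_n G_2 / G_{n+2}` of `criticalCorr 3` at `n + 2 = 4` resp.
even `n + 2 ≥ 6` sources.  Proof: C/D feed B (denominators non-zero by A), giving the limit-ratio
inequality; `oneSided_of_ratio` (odd orders `limit_odd_eq_zero`, two-point law `two_point_config`,
coincident configurations by the normalisation) gives the one-sided inequality; the squeeze
`isInversionCovariant_of_oneSided` concludes.  C and D are OPEN (the `n ≥ 4` Möbius covariance of
the Ising₃ limit in lattice form). [folklore] -/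
theorem InversionUpgradeNormalised_of_stubs
    (hA : ∀ (ρ : ℝ → ℝ) (S : CorrFamily 3), (∀ δ ∈ Set.Ioc (0:ℝ) 1, 0 < ρ δ) →
      HasPointwiseScalingLimit (criticalCorr 3) ρ S → IsNondegenerateTwoPoint S →
      ∀ n : ℕ, Even n → ∀ x ∈ NonCoincident 3 n, 0 < S n x)
    (hB : ∀ (ρ : ℝ → ℝ) (S : CorrFamily 3), (∀ δ ∈ Set.Ioc (0:ℝ) 1, 0 < ρ δ) →
      HasPointwiseScalingLimit (criticalCorr 3) ρ S →
      ∀ (n : ℕ) (x y : Fin (n + 2) → EuclideanSpace ℝ (Fin 3)),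
        x ∈ NonCoincident 3 (n + 2) → y ∈ NonCoincident 3 (n + 2) →
        S (n + 2) x ≠ 0 → S (n + 2) y ≠ 0 →
        (∀ ε : ℝ, 0 < ε → ∀ᶠ δ in 𝓝[>] (0:ℝ),
          criticalCorr 3 n (fun i => latticeApprox δ (x (Fin.castAdd 2 i))) *
              criticalCorr 3 2 (fun i => latticeApprox δ (x (Fin.natAdd n i))) /
            criticalCorr 3 (n + 2) (fun i => latticeApprox δ (x i)) ≤
          criticalCorr 3 n (fun i => latticeApprox δ (y (Fin.castAdd 2 i))) *
              criticalCorr 3 2 (fun i => latticeApprox δ (y (Fin.natAdd n i))) /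
            criticalCorr 3 (n + 2) (fun i => latticeApprox δ (y i)) + ε) →
        S n (fun i => x (Fin.castAdd 2 i)) * S 2 (fun i => x (Fin.natAdd n i)) /
            S (n + 2) x ≤
        S n (fun i => y (Fin.castAdd 2 i)) * S 2 (fun i => y (Fin.natAdd n i)) /
            S (n + 2) y)
    (hC : ∀ (ρ : ℝ → ℝ) (Δ : ℝ) (S : CorrFamily 3), (∀ δ ∈ Set.Ioc (0:ℝ) 1, 0 < ρ δ) →
      HasPointwiseScalingLimit (criticalCorr 3) ρ S →
      (∀ n z, z ∉ NonCoincident 3 n → S n z = 0) → IsNondegenerateTwoPoint S →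
      IsEuclideanInvariant S → IsScaleCovariant Δ S →
      ∀ x : Fin (2 + 2) → EuclideanSpace ℝ (Fin 3), x ∈ NonCoincident 3 (2 + 2) →
        (∀ i, x i ≠ 0) → (∀ i, ‖x i‖ < 1) →
        ∀ ε : ℝ, 0 < ε → ∀ᶠ δ in 𝓝[>] (0:ℝ),
          criticalCorr 3 2 (fun i => latticeApprox δ (x (Fin.castAdd 2 i))) *
              criticalCorr 3 2 (fun i => latticeApprox δ (x (Fin.natAdd 2 i))) /
            criticalCorr 3 (2 + 2) (fun i => latticeApprox δ (x i)) ≤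
          criticalCorr 3 2 (fun i => latticeApprox δ (inversion 0 1 (x (Fin.castAdd 2 i)))) *
              criticalCorr 3 2 (fun i => latticeApprox δ (inversion 0 1 (x (Fin.natAdd 2 i)))) /
            criticalCorr 3 (2 + 2) (fun i => latticeApprox δ (inversion 0 1 (x i))) + ε)
    (hD : ∀ (ρ : ℝ → ℝ) (Δ : ℝ) (S : CorrFamily 3), (∀ δ ∈ Set.Ioc (0:ℝ) 1, 0 < ρ δ) →
      HasPointwiseScalingLimit (criticalCorr 3) ρ S →
      (∀ n z, z ∉ NonCoincident 3 n → S n z = 0) → IsNondegenerateTwoPoint S →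
      IsEuclideanInvariant S → IsScaleCovariant Δ S →
      ∀ n : ℕ, Even n → 4 ≤ n →
        ∀ x : Fin (n + 2) → EuclideanSpace ℝ (Fin 3), x ∈ NonCoincident 3 (n + 2) →
          (∀ i, x i ≠ 0) → (∀ i, ‖x i‖ < 1) →
          ∀ ε : ℝ, 0 < ε → ∀ᶠ δ in 𝓝[>] (0:ℝ),
          criticalCorr 3 n (fun i => latticeApprox δ (x (Fin.castAdd 2 i))) *
              criticalCorr 3 2 (fun i => latticeApprox δ (x (Fin.natAdd n i))) /
            criticalCorr 3 (n + 2) (fun i => latticeApprox δ (x i)) ≤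
          criticalCorr 3 n (fun i => latticeApprox δ (inversion 0 1 (x (Fin.castAdd 2 i)))) *
              criticalCorr 3 2 (fun i => latticeApprox δ (inversion 0 1 (x (Fin.natAdd n i)))) /
            criticalCorr 3 (n + 2) (fun i => latticeApprox δ (inversion 0 1 (x i))) + ε) :
    Summit.CriticalPhenomena.Ising3DConformalLimit.Theses.HyperoctahedralRP.InversionUpgradeNormalised := by
  intro ρ Δ S hρ hlim hnorm hnd heuc hsc
  refine isInversionCovariant_of_oneSided hsc ?_
  have hpos : ∀ n : ℕ, Even n → ∀ x ∈ NonCoincident 3 n, 0 < S n x := hA ρ S hρ hlim hnd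
  refine oneSided_of_ratio hnorm ?_ hpos ?_ ?_
  · intro n hn x _
    exact limit_odd_eq_zero hlim hnorm hn x
  · intro x hinj hx0
    exact two_point_config heuc hsc hinj hx0
  · intro n hn h2n x hx hx0 hx1
    have hιx : (fun i => inversion (0 : EuclideanSpace ℝ (Fin 3)) 1 (x i)) ∈ NonCoincident 3 (n + 2) :=
      injective_inv_comp hx
    have hne : S (n + 2) x ≠ 0 := (hpos (n + 2) (by simpa [Nat.even_add] using hn) x hx).ne'
    have hne' : S (n + 2) (fun i => inversion 0 1 (x i)) ≠ 0 :=
      (hpos (n + 2) (by simpa [Nat.even_add] using hn) _ hιx).ne'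
    refine hB ρ S hρ hlim n x _ hx hιx hne hne' ?_
    rcases eq_or_lt_of_le h2n with rfl | hlt
    · exact hC ρ Δ S hρ hlim hnorm hnd heuc hsc x hx hx0 hx1
    · have h4 : 4 ≤ n := by rcases hn with ⟨k, rfl⟩; omega
      exact hD ρ Δ S hρ hlim hnorm hnd heuc hsc n hn h4 x hx hx0 hx1

end Summit.CriticalPhenomena.Ising3DConformalLimit.Cruxes.InversionUpgradeNormalised.InversionDefectInvolution

end
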